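import Literature.NumberTheory.EllipticCurves.BigRepModuleDualShiftedEndomorphismProofs
import Literature.NumberTheory.EllipticCurves.BigRepModuleShiftedCokernelFiniteProofs
import Literature.NumberTheory.EllipticCurves.BigRepModuleFiniteCoeffDualProofs
import Mathlib.LinearAlgebra.Matrix.ToLinearEquiv
import HarnessLib

/-!
# The COKERNEL of a shifted endomorphism `τ_c ∘ F_* − 1` of `A ⊗ Λ^*`: zero for COFREE `A` when
# `det((1+T)^c·ᵗM − 1) ≠ 0`, finite for FINITE `A` (`c ≠ 0`), finite for cofinitely generated `A` — PROVED

Topic `Literature/NumberTheory/EllipticCurves` (namespace = path + `BigRepModule`). THEOREMS ONLY: no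
definition, no named fact, no instance, no `sorry`. Cell `bsd-stepL` (typer lane `defn-ty1`, g10):
module L5 step **(S2)** of the discharge of the local atom
`JetchevSkinnerWan2017.sigmaLocal_charIdeal_eulerFactor_mem_of_noTamagawaDefect` (K2 support 20495) at a
FINITELY DECOMPOSED place: `H¹(D_w/I_w, M^{I_w}) = M^{I_w}/(φ_w − 1)M^{I_w}` with
`M^{I_w} = (E[p^∞]^{I_w}) ⊗ Λ^*` and `φ_w` acting as a shifted endomorphism, so this group — the finite
(pseudo-null) error term of [GreenbergVatsal2000] Prop. 2.4's inflation–restriction — is the cokernel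
computed here.

## The printed statement

[GreenbergVatsal2000] proof of Prop. (2.4) (arXiv:math/9906215 pp. 21–22): "`G/Ī_ℓ` has profinite
order prime to `p` and so `H¹(G, A_{I_ℓ}) ≅ H¹(Ī_ℓ, A_{J_ℓ})^{G/Ī_ℓ}`" (over `ℚ`; in general the
inflation term `H¹(D_w/I_w, M^{I_w})` is FINITE at a finitely decomposed place, which is what the
characteristic-ideal computation needs); [Greenberg2006] p. 342 ("`𝒟` is a cofree `Λ`-module").

## What is proved (tree's co-induced model `L(A) = BigRepModule 𝒪 p A`; `E Φ = τ_c (F_* Φ) − Φ`)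

* **`surjective_shiftedEndo_of_det_ne_zero`** — for `A` `p`-primary and COFREE (dual datum `(Y, tA)`
  with basis `b`), `F : A → A` with adjoint `Lt`, `c ∈ ℤ_p`: if `det N ≠ 0`, `N = (1+T)^c·ᵗM − 1`
  (`ᵗM = (toMatrix b b Lt).map C`), then `E` is SURJECTIVE (`E^∨ ≃ N` is injective over the domain
  `𝒪⟦T⟧`, tree `dual_mahlerEquiv_apply`; Pontryagin: `E^∨` injective ⟺ `E` surjective), i.e.
  `coker E = 0`;
* `finite_quotient_range_shiftedEndo` — for FINITE `A` and `c ≠ 0`, `L(A) ⧸ E(L(A))` is finite (the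
  tree's `finite_quotient_range_shift_sub_id`, imc-p1 g13, re-keyed to any `𝒪⟦T⟧`-linear `E`);
* **`finite_quotient_range_shiftedEndo_of_exact`** — for `p`-primary `0 → D —ι→ B —π→ Q → 0` exact
  (`ι` injective, `π` surjective), `D` cofree with `det N_D ≠ 0`, `Q` finite, `c ≠ 0`, compatible
  `F_D, F_B, F_Q`, and ANY `Λ`-linear `E_B` with `E_B Φ = τ_c (F_{B*} Φ) − Φ`:
  `L(B) ⧸ E_B(L(B))` is FINITE (it injects into `L(Q) ⧸ E_Q(L(Q))` because `E_D` is onto).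

HONEST FRAMING: pure `Λ`-module algebra of the co-induced module; nothing about Galois cohomology or BSD
is proved here and the named local fact is NOT discharged by this file.

References: [GreenbergVatsal2000] Prop. 2.4 and proof (arXiv pp. 21–22); [Greenberg2006] p. 342;
[CoatesSujatha2006Cyclotomic] §3.3 Lemma 3.3.4; [PollackWeston2011] Lemma 3.2.
-/

noncomputable section

open Literature.NumberTheory.IwasawaTheory.Greenberg2016

namespace Literature.NumberTheory.EllipticCurves.BigRepModule

/-! ## §1 Cofree coefficients: `E` is onto when `det N ≠ 0` -/

section Cofree

universe u

variable {𝒪 : Type u} [CommRing 𝒪] {p : ℕ} [Fact p.Prime] [Algebra ℤ_[p] 𝒪]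
  {A : Type u} [AddCommGroup A] [Module 𝒪 A]
  {Y : Type u} [AddCommGroup Y] [Module 𝒪 Y] {tA : Y →+ (A →+ AddCircle (1 : ℚ))} {n : ℕ}

/-- **`τ_c ∘ F_* − 1` is ONTO `A ⊗ Λ^*` for cofree `A` when `det((1+T)^c·ᵗM − 1) ≠ 0`** (and
`𝒪⟦T⟧` is a domain): its Pontryagin dual is conjugate to the matrix `N = (1+T)^c·ᵗM − 1` acting on
`Fin n → 𝒪⟦T⟧` (`dual_mahlerEquiv_apply`), which is injective as `det N ≠ 0`
(`Matrix.exists_mulVec_eq_zero_iff`), and `E^∨` injective ⟺ `E` surjective (`ℚ/ℤ` is an injective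
cogenerator). So the cokernel `L(A) ⧸ E(L(A))` vanishes. [cite: Greenberg2006, p. 342 L4–11 (𝒟 cofree)]
[cite: GreenbergVatsal2000, Prop. 2.4 and proof (arXiv pp. 21–22)] -/
theorem surjective_shiftedEndo_of_det_ne_zero [IsDomain (PowerSeries 𝒪)]
    (hA : ∀ a : A, ∃ k : ℕ, p ^ k • a = 0) (hY : IsDualPairing 𝒪 A tA)
    (b : Module.Basis (Fin n) 𝒪 Y) (L : A →ₗ[𝒪] A) (Lt : Y →ₗ[𝒪] Y)
    (hLt : ∀ (y : Y) (a : A), tA (Lt y) a = tA y (L a)) (c : ℤ_[p])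
    (E : BigRepModule 𝒪 p A →ₗ[PowerSeries 𝒪] BigRepModule 𝒪 p A)
    (hE : ∀ Φ, E Φ = translate c (mapRange L Φ) - Φ)
    (hN : (binomSeries 𝒪 c • (LinearMap.toMatrix b b Lt).map (PowerSeries.C (R := 𝒪)) - 1).det ≠ 0) :
    Function.Surjective E := by
  classical
  set N := binomSeries 𝒪 c • (LinearMap.toMatrix b b Lt).map (PowerSeries.C (R := 𝒪)) - 1 with hNdef
  set Θ := (isDualPairing_seriesToDual hA b hY).linearEquiv
    (isDualPairing_characterModule (PowerSeries 𝒪) (BigRepModule 𝒪 p A)) with hΘ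
  -- `N` is injective on `Fin n → 𝒪⟦T⟧`
  have hNinj : Function.Injective N.mulVecLin := by
    rw [← LinearMap.ker_eq_bot, LinearMap.ker_eq_bot']
    intro v hv
    by_contra hv0
    exact hN (Matrix.exists_mulVec_eq_zero_iff.mp ⟨v, hv0, by simpa using hv⟩)
  -- hence `E^∨` is injective (conjugate to `N` by `Θ`)
  have hdual : Function.Injective (CharacterModule.dual E) := by
    intro x y hxy
    obtain ⟨G, rfl⟩ := Θ.surjective x
    obtain ⟨G', rfl⟩ := Θ.surjective y
    rw [dual_mahlerEquiv_apply hA hY b L Lt hLt c E hE, dual_mahlerEquiv_apply hA hY b L Lt hLt c E hE]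
      at hxy
    rw [hNinj (Θ.injective hxy)]
  exact CharacterModule.dual_injective_iff_surjective.mp hdual

end Cofree

/-! ## §2 Finite coefficients: the cokernel is finite (`c ≠ 0`) -/

section FiniteCoeff

variable {𝒪 : Type*} [CommRing 𝒪] {p : ℕ} [Fact p.Prime] {A : Type*} [AddCommGroup A] [Module 𝒪 A]

/-- **For FINITE `A` and `c ≠ 0` the cokernel `L(A) ⧸ E(L(A))` of `E = τ_c ∘ F_* − 1` is finite** —
the tree's `finite_quotient_range_shift_sub_id` (shift `−(−c)`), transported from the `𝒪`-submodule
`range(F_* ∘ τ_c − 1)` to the `𝒪⟦T⟧`-submodule `range E` (same underlying subgroup).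
[cite: GreenbergVatsal2000, Prop. 2.4 (finitely decomposed primes)] -/
theorem finite_quotient_range_shiftedEndo [Finite A] (F : A →ₗ[𝒪] A) {c : ℤ_[p]} (hc : c ≠ 0)
    (E : BigRepModule 𝒪 p A →ₗ[PowerSeries 𝒪] BigRepModule 𝒪 p A)
    (hE : ∀ Φ, E Φ = translate c (mapRange F Φ) - Φ) :
    Finite (BigRepModule 𝒪 p A ⧸ LinearMap.range E) := by
  have h := finite_quotient_range_shift_sub_id (p := p) F (neg_ne_zero.mpr hc)
  rw [neg_neg] at h
  have hrange : (LinearMap.range E).restrictScalars 𝒪 =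
      LinearMap.range ((mapRange (p := p) F).comp (translate c) - LinearMap.id) := by
    ext Φ
    simp only [Submodule.restrictScalars_mem, LinearMap.mem_range, LinearMap.sub_apply,
      LinearMap.comp_apply, LinearMap.id_apply]
    constructor
    · rintro ⟨y, rfl⟩
      exact ⟨y, by rw [mapRange_translate, ← hE]⟩
    · rintro ⟨y, rfl⟩
      exact ⟨y, by rw [hE, mapRange_translate]⟩
  have e := (Submodule.Quotient.restrictScalarsEquiv 𝒪 (LinearMap.range E)).symm.trans
    (Submodule.quotEquivOfEq _ _ hrange)
  exact Finite.of_equiv _ e.toEquiv.symm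

end FiniteCoeff

/-! ## §3 Cofinitely generated coefficients: `0 → D → B → Q → 0` -/

section Cofinite

variable {p : ℕ} [Fact p.Prime]
  {D B Q : Type} [AddCommGroup D] [Module ℤ_[p] D] [AddCommGroup B] [Module ℤ_[p] B]
  [AddCommGroup Q] [Module ℤ_[p] Q]

/-- `τ_c ∘ F_* − 1` is `Λ`-linear (`τ_c = (1+T)^c •`), so there is an `𝒪⟦T⟧`-linear `E` with
`E Φ = τ_c (F_* Φ) − Φ`. [cite: CoatesSujatha2006Cyclotomic, Lemma 3.3.4 (§3.3 p. 37: 1_{ℤ_p} ↦ 1 + T)] -/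
private theorem exists_shiftedEndo' {X : Type} [AddCommGroup X] [Module ℤ_[p] X]
    (F : X →ₗ[ℤ_[p]] X) (c : ℤ_[p]) :
    ∃ E : BigRepModule ℤ_[p] p X →ₗ[PowerSeries ℤ_[p]] BigRepModule ℤ_[p] p X,
      ∀ Φ, E Φ = translate c (mapRange F Φ) - Φ :=
  ⟨LinearMap.lsmul (PowerSeries ℤ_[p]) (BigRepModule ℤ_[p] p X) (binomSeries ℤ_[p] c) ∘ₗ
      mapRangeₗ F - LinearMap.id,
    fun Φ ↦ by
      rw [LinearMap.sub_apply, LinearMap.comp_apply, LinearMap.lsmul_apply, mapRangeₗ_apply,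
        LinearMap.id_apply, translate_eq_binomSeries_smul]⟩

/-- Naturality: `L_* (E Φ) = E' (L_* Φ)` for `L` intertwining `F`, `F'`.
[cite: GreenbergVatsal2000, proof of Prop. 2.4 (arXiv p. 22)] -/
private theorem mapRange_shiftedEndo' {X X' : Type} [AddCommGroup X] [Module ℤ_[p] X]
    [AddCommGroup X'] [Module ℤ_[p] X'] (L : X →ₗ[ℤ_[p]] X') (F : X →ₗ[ℤ_[p]] X)
    (F' : X' →ₗ[ℤ_[p]] X') (hLF : L ∘ₗ F = F' ∘ₗ L) (c : ℤ_[p])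
    (E : BigRepModule ℤ_[p] p X →ₗ[PowerSeries ℤ_[p]] BigRepModule ℤ_[p] p X)
    (hE : ∀ Φ, E Φ = translate c (mapRange F Φ) - Φ)
    (E' : BigRepModule ℤ_[p] p X' →ₗ[PowerSeries ℤ_[p]] BigRepModule ℤ_[p] p X')
    (hE' : ∀ Φ, E' Φ = translate c (mapRange F' Φ) - Φ) (Φ : BigRepModule ℤ_[p] p X) :
    mapRange L (E Φ) = E' (mapRange L Φ) := by
  rw [hE, hE', map_sub, mapRange_translate, ← LinearMap.comp_apply (mapRange L) (mapRange F),
    ← mapRange_comp, hLF, mapRange_comp, LinearMap.comp_apply]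

/-- **The cokernel of `τ_c ∘ F_{B*} − 1` on `B ⊗ Λ^*` is FINITE for cofinitely generated `B`**: given
`p`-primary `0 → D —ι→ B —π→ Q → 0` exact (`ι` injective, `π` surjective) with `D` COFREE (dual datum
`(Y, tD)`, basis `b`), `Q` FINITE, compatible endomorphisms `F_D, F_B, F_Q`, an adjoint `Lt` of `F_D`,
`c ≠ 0` with `det((1+T)^c·ᵗM − 1) ≠ 0`, and ANY `Λ`-linear `E_B` with `E_B Φ = τ_c (F_{B*} Φ) − Φ`:
`L(B) ⧸ E_B(L(B))` injects into the finite `L(Q) ⧸ E_Q(L(Q))` (diagram chase: `E_D` is onto by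
`surjective_shiftedEndo_of_det_ne_zero`, `X ↦ L(X)` is exact, tree `exact_mapRangeₗ_of_injective` ∕
`mapRange_surjective_of_surjective`). [cite: GreenbergVatsal2000, Prop. 2.4 and proof (arXiv pp. 21–22)] -/
theorem finite_quotient_range_shiftedEndo_of_exact
    (hD : ∀ d : D, ∃ k : ℕ, p ^ k • d = 0) (hB : ∀ x : B, ∃ k : ℕ, p ^ k • x = 0) [Finite Q]
    (ι : D →ₗ[ℤ_[p]] B) (hι : Function.Injective ι) (π : B →ₗ[ℤ_[p]] Q)
    (hπ : Function.Surjective π) (hιπ : Function.Exact ι π)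
    {Y : Type} [AddCommGroup Y] [Module ℤ_[p] Y] {tD : Y →+ (D →+ AddCircle (1 : ℚ))}
    (hY : IsDualPairing ℤ_[p] D tD) {n : ℕ} (b : Module.Basis (Fin n) ℤ_[p] Y)
    (F_D : D →ₗ[ℤ_[p]] D) (F_B : B →ₗ[ℤ_[p]] B) (F_Q : Q →ₗ[ℤ_[p]] Q)
    (hFι : ι ∘ₗ F_D = F_B ∘ₗ ι) (hFπ : π ∘ₗ F_B = F_Q ∘ₗ π)
    (Lt : Y →ₗ[ℤ_[p]] Y) (hLt : ∀ (y : Y) (d : D), tD (Lt y) d = tD y (F_D d))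
    {c : ℤ_[p]} (hc : c ≠ 0)
    (E_B : BigRepModule ℤ_[p] p B →ₗ[PowerSeries ℤ_[p]] BigRepModule ℤ_[p] p B)
    (hE_B : ∀ Φ, E_B Φ = translate c (mapRange F_B Φ) - Φ)
    (hN : (binomSeries ℤ_[p] c • (LinearMap.toMatrix b b Lt).map (PowerSeries.C (R := ℤ_[p])) - 1).det
      ≠ 0) :
    Finite (BigRepModule ℤ_[p] p B ⧸ LinearMap.range E_B) := by
  obtain ⟨E_D, hE_D⟩ := exists_shiftedEndo' (p := p) F_D c
  obtain ⟨E_Q, hE_Q⟩ := exists_shiftedEndo' (p := p) F_Q c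
  have hsurjD : Function.Surjective E_D :=
    surjective_shiftedEndo_of_det_ne_zero hD hY b F_D Lt hLt c E_D hE_D hN
  haveI : Finite (BigRepModule ℤ_[p] p Q ⧸ LinearMap.range E_Q) :=
    finite_quotient_range_shiftedEndo F_Q hc E_Q hE_Q
  have hex := exact_mapRangeₗ_of_injective (p := p) hι hιπ
  have hπsurj : Function.Surjective (mapRange (p := p) π) := mapRange_surjective_of_surjective hπ hB
  -- the induced map on cokernels
  have hle : LinearMap.range E_B ≤ (LinearMap.range E_Q).comap (mapRangeₗ (p := p) π) := by
    rintro _ ⟨y, rfl⟩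
    exact ⟨mapRange π y, by
      rw [mapRangeₗ_apply, mapRange_shiftedEndo' π F_B F_Q hFπ c E_B hE_B E_Q hE_Q]⟩
  set θ := (LinearMap.range E_B).mapQ (LinearMap.range E_Q) (mapRangeₗ (p := p) π) hle with hθ
  refine Finite.of_injective θ ?_
  rw [injective_iff_map_eq_zero]
  intro q hq
  obtain ⟨x, rfl⟩ := Submodule.Quotient.mk_surjective _ q
  rw [hθ, Submodule.mapQ_apply, Submodule.Quotient.mk_eq_zero] at hq
  obtain ⟨y', hy'⟩ := hq
  obtain ⟨y, rfl⟩ := hπsurj y'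
  -- `π_* (x − E_B y) = 0`, so `x − E_B y = ι_* z` with `z = E_D w`
  have h0 : mapRangeₗ (p := p) π (x - E_B y) = 0 := by
    rw [map_sub, sub_eq_zero, ← hy', mapRangeₗ_apply,
      mapRange_shiftedEndo' π F_B F_Q hFπ c E_B hE_B E_Q hE_Q]
  obtain ⟨z, hz⟩ := (hex _).mp h0
  obtain ⟨w, rfl⟩ := hsurjD z
  rw [Submodule.Quotient.mk_eq_zero]
  refine ⟨y + mapRange ι w, ?_⟩
  rw [map_add, ← mapRange_shiftedEndo' ι F_D F_B hFι c E_D hE_D E_B hE_B, ← mapRangeₗ_apply, hz,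
    add_sub_cancel]

end Cofinite

end Literature.NumberTheory.EllipticCurves.BigRepModule
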